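import Summits.BirchSwinnertonDyer.BirchSwinnertonDyer.Theorems.AdditiveBranchIMCMultLowerVisibilityRecordsHesse
import HarnessLib

/-!
# Crux `MultLower` (item 19359, owner k1-c4): the (M) CONTENT-window rank-one visibility records with the `3`-CONGRUENCE PROVED IN THE
# KERNEL, part 2 — `E ∈ {184455f1, 393183l1, 409149y1}` (part 1 = `…MultLowerVisibilityRecordsHesse.lean`: the `_of_lower` door + `117648y1`, `165609d1`)

Cell `bsd-addord`, seat `bsd-addord-k1-c3` (D-0074 row B2), gen 8; `--supports stmt-BirchSwinnertonDyer-19359 --as helper`. Same shape, same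
sources and same HONEST FRAMING as part 1 (nothing here proves BSD or the crux; THEOREMS ONLY; per pair; NOT a class theorem; nothing booked):
per key `threeCongruent_c<E>_c<F>` (Fisher Hesse-pencil certificate, kernel), `missingLowerBoundAt_c<E>_3` (binders `hCT hGZK`, `hWeq`, `hr1`,
`hq`/`hv` only) and `bsdp_c<E>_3` (X4(M) ∩ surj rank-one door `…_of_lower` of part 1).

Certificates: `184455f1 ← 184455a1` dual `(−75513 : 47)`, `u = 1/6`; `393183l1 ← 393183a1` dual `(−13983 : 1)`, `u = 1/474`;
`409149y1 ← 409149g1` direct `(−1203852 : 5)`, `u = 164268`.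

References: [Fisher2012Hessian] §8, §13, Thm. 13.2; [CremonaMazur2000] §3; [AgasheStein2002] Lemma 3.6; [Kato2004Asterisque] Thm. 17.4;
[Delbourgo2002] Thm. (A), (B); [Cremona2006] Table 1.
-/

set_option autoImplicit false
set_option linter.dupNamespace false

noncomputable section

open scoped Classical MatrixGroups ModularForm NumberField
open CongruenceSubgroup WeierstrassCurve NumberField IsDedekindDomain Field
  Literature.NumberTheory.EllipticCurves Literature.NumberTheory.EllipticCurves.ModularForms
  Literature.NumberTheory.EllipticCurves.Rank1Residual
  Literature.NumberTheory.EllipticCurves.Rank1Residual.Typed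
  Literature.NumberTheory.EllipticCurves.Delbourgo2002
  Literature.NumberTheory.EllipticCurves.Disegni2017
  Literature.NumberTheory.EllipticCurves.Fisher2012
  Literature.NumberTheory.QuadraticFields
  Literature.NumberTheory.GaloisRepresentations
  Summit.BirchSwinnertonDyer.Rank1Residual.Additive
  Summit.BirchSwinnertonDyer.Rank1Residual.AdditivePotMult

namespace Summit.BirchSwinnertonDyer.BirchSwinnertonDyer.Theorems.AdditiveBranchIMCMultLowerVisibility

open Summit.BirchSwinnertonDyer.BirchSwinnertonDyer.Theorems.AdditiveBranchIMCGordTwoRankOneVisibility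
open Summit.BirchSwinnertonDyer.BirchSwinnertonDyer.Theorems.AdditiveBranchIMCMultLower

/-! ### `184455f1` ← `184455a1` (dual pencil) -/

/-- **The `3`-congruence `184455a1[3] ≅ 184455f1[3]` PROVED IN THE KERNEL** (no named fact): `F = 184455a1 = [0, 0, 1, -3477, 78502]` is `ℚ`-isomorphic to the member
`(λ : μ) = (-75513 : 47)` of the DUAL Hesse pencil `X_E⁻(3)` (Fisher 2012 §13) of `E = 184455f1 = [1, -1, 0, -12069, -540032]` —
the two covariant identities `−𝔇(λ,μ)/(4Δ′) = u⁴·c₄(F)`, `−𝔠₆(λ,μ)/(8Δ′²) = u⁶·c₆(F)` (`Δ′ = c₄(E)³ − c₆(E)²`) with `u = 1/6`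
(`c₄(E) = 579321`, `c₆(E) = 469194579`, `c₄(F) = 166896`, `c₆(F) = -67825944`) are checked by `norm_num` on the tree's closed forms
(`eval_hesseC4three` / `eval_hesseC6three` / `eval_hesseD3`) and fed to the PROVED transport
`Fisher2012.threeCongruent_of_dualHesseCertificate_unconditional`; certificate found by the seat's exact finder `find_hesse3.py`
(rational roots of the degree-12 form `𝔠₄′(λ,1)³c₆(F)² − 𝔠₆′(λ,1)²c₄(F)³`, k1-c3 g8). Hypothesis: the target model `hWeq` only.
[cite: Fisher2012Hessian, §13 (analogue of Thm. 13.2 for X_E^-(3))] [cite: Cremona2006, Table 1 (Cremona labels 184455f1, 184455a1)] -/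
theorem threeCongruent_c184455f1_c184455a1 (W : WeierstrassCurve ℚ) [W.IsElliptic] (hWeq : W = ⟨1, -1, 0, -12069, -540032⟩) :
    ∃ θ : geomTorsion (⟨0, 0, 1, -3477, 78502⟩ : WeierstrassCurve ℚ) (3 : ℤ) ≃+ geomTorsion W (3 : ℤ),
      ∀ (σ : Field.absoluteGaloisGroup ℚ) (P : geomTorsion (⟨0, 0, 1, -3477, 78502⟩ : WeierstrassCurve ℚ) (3 : ℤ)),
        θ (σ • P) = σ • θ P := by
  haveI := isElliptic_c184455a1
  have hc4 : W.c₄ = (579321 : ℚ) := by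
    subst hWeq; norm_num [WeierstrassCurve.c₄, WeierstrassCurve.b₂, WeierstrassCurve.b₄]
  have hc6 : W.c₆ = (469194579 : ℚ) := by
    subst hWeq; norm_num [WeierstrassCurve.c₆, WeierstrassCurve.b₂, WeierstrassCurve.b₄, WeierstrassCurve.b₆]
  have hc4F : (⟨0, 0, 1, -3477, 78502⟩ : WeierstrassCurve ℚ).c₄ = (166896 : ℚ) := by
    norm_num [WeierstrassCurve.c₄, WeierstrassCurve.b₂, WeierstrassCurve.b₄]
  have hc6F : (⟨0, 0, 1, -3477, 78502⟩ : WeierstrassCurve ℚ).c₆ = (-67825944 : ℚ) := by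
    norm_num [WeierstrassCurve.c₆, WeierstrassCurve.b₂, WeierstrassCurve.b₄, WeierstrassCurve.b₆]
  exact threeCongruent_of_dualHesseCertificate_unconditional W (⟨0, 0, 1, -3477, 78502⟩ : WeierstrassCurve ℚ)
    (-75513 : ℚ) (47 : ℚ) ((1 : ℚ) / 6) (by norm_num)
    (by rw [hc4, hc6, hc4F, eval_hesseD3]; norm_num) (by rw [hc4, hc6, hc6F, eval_hesseC6three]; norm_num)

/-- **`ord₃ #Ш(E)_an ≤ ord₃ #Ш(E)` for `E = 184455f1` (crux 19359's conclusion `MissingLowerBoundAt W 3` AT THE PAIR), `3`-congruence PROVED IN THE KERNEL.**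
Binders: cite-only `hCT hGZK`; the model `hWeq`; Cremona's `r_an = 1` (`hr1`) and `#Ш(E)_an = q`, `ord₃ q ≤ 2` (`hq`/`hv`). Everything else —
the partner `F = 184455a1` (rank `3`), its minimal model, the two witnesses and their local `3`-divisibility, independence mod `3F(ℚ)`,
`E[3]` irreducible, AND the `3`-congruence `F[3] ≅ E[3]` — is decided in the kernel (`missingLowerBoundAt_c184455f1_3_of_congr` +
`threeCongruent_c184455f1_c184455a1`). Per pair; NOT a class theorem; nothing booked. [cite: CremonaMazur2000, §3] [cite: AgasheStein2002, Lemma 3.6]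
[cite: Fisher2012Hessian, Thm. 13.2 and §13 (n = 3)] [cite: Cremona2006, Table 1 (Cremona labels 184455f1, 184455a1)] -/
theorem missingLowerBoundAt_c184455f1_3
    (hCT : exists_casselsTate_pairing (K := ℚ)) (hGZK : rank_eq_analyticRank_of_analyticRank_le_one)
    {W : WeierstrassCurve ℚ} [W.IsElliptic] [W.IsGloballyMinimal] (hWeq : W = ⟨1, -1, 0, -12069, -540032⟩)
    (hr1 : W.analyticRank = 1) {q : ℚ} (hq : shaAn W = (q : ℂ)) (hv : padicValRat 3 q ≤ 2) :
    MissingLowerBoundAt W 3 := by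
  haveI := isElliptic_c184455a1
  haveI := isGloballyMinimal_c184455a1
  obtain ⟨θ, hθ⟩ := threeCongruent_c184455f1_c184455a1 W hWeq
  exact missingLowerBoundAt_c184455f1_3_of_congr (F := (⟨0, 0, 1, -3477, 78502⟩ : WeierstrassCurve ℚ)) hCT hGZK hWeq rfl hr1 hq hv θ hθ

/-- **`BSD(E,3)` for `E = 184455f1` BY NAME on cell X4(M) ∩ surj, `3`-congruence PROVED IN THE KERNEL** — cite-only
`hCyc h73 hWald hmodN hDelM hK hmod hmodD hGZK hCT`; the model `hWeq`; data-level flags `ClassX4M W 3`, `Surj W 3`, `r_an = 1`; the bit `A′ ≠ 0` on the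
multiplicative `χ₋₃`-branch (`hne`, k1-c4's two-engine shape); the EXACT datum `#Ш(E)_an = q`, `ord₃ q ≤ 2`. NO partner binder, NO `θ`
(`…_of_lower` + `missingLowerBoundAt_c184455f1_3`). Per pair; NOT a class theorem; nothing booked.
[cite: Kato2004Asterisque, Thm. 17.4 (3) (p. 273)] [cite: Delbourgo2002, Theorem (A), (B) (p. 40)] [cite: CremonaMazur2000, §3]
[cite: Fisher2012Hessian, Thm. 13.2 and §13 (n = 3)] [cite: Cremona2006, Table 1 (Cremona labels 184455f1, 184455a1)] -/
theorem bsdp_c184455f1_3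
    (hCyc : delbourgoDatum_cycLineGrossZagier) (h73 : GrossZagier1986_thm_I_7_3)
    (hWald : waldspurger_exists_heegnerField_twist_ne_zero) (hmodN : exists_isNewformOf)
    (hDelM : Delbourgo2002.mainTheorem_potMult)
    (hK : Wuthrich2014.kato_halfEigenCharIdeal_dvd_cyclotomicPrime_of_surjective)
    (hmod : hasEntireLFunction_rat) (hmodD : nonempty_modularParametrizationData)
    (hGZK : rank_eq_analyticRank_of_analyticRank_le_one) (hCT : exists_casselsTate_pairing (K := ℚ))
    {W : WeierstrassCurve ℚ} [W.IsElliptic] [W.IsGloballyMinimal] (hWeq : W = ⟨1, -1, 0, -12069, -540032⟩)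
    (hX : ClassX4M W 3) (hsurj : Surj W 3) (hr1 : W.analyticRank = 1)
    (hne : ∀ (V : WeierstrassCurve ℚ) [V.IsElliptic] [V.IsGloballyMinimal] (C : VariableChange ℚ),
      Mult V 3 → C • V.quadraticTwist ((-1 : ℚ) ^ (3 / 2) * 3) = W →
      ∀ {N : ℕ} [NeZero N] (f : CuspForm (Gamma0 N) 2), IsNewformOf V f → ∀ (ap : ℤ), cuspCoeff f 3 = ap →
      ∀ ϖ : ℚ, (if Even (3 / 2) then (ϖ : ℝ) * V.realPeriodRat = plusPeriod f
          else (ϖ : ℝ) * V.imaginaryPeriodRat = minusPeriod f) →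
        PowerSeries.coeff 1 (PowerSeries.C (ϖ : ℚ_[3]) *
            (if Even (3 / 2) then padicLFunctionPlusBranchMult f (ap : ℚ_[3]) (3 / 2)
              else padicLFunctionMinusBranchMult f (ap : ℚ_[3]) (3 / 2))) ≠ 0)
    {q : ℚ} (hq : shaAn W = (q : ℂ)) (hv : padicValRat 3 q ≤ 2) : BSDp W 3 :=
  haveI : Fact (Nat.Prime 3) := ⟨Nat.prime_three⟩
  classX4M_bsdp_rankOne_of_cycLineFact_of_katoHalf_of_multCoeffOneNeZero_of_lower hCyc h73 hWald hmodN hDelM hK hmod hmodD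
    hGZK hX hsurj hr1 hne (missingLowerBoundAt_c184455f1_3 hCT hGZK hWeq hr1 hq hv)

/-! ### `393183l1` ← `393183a1` (dual pencil) -/

/-- **The `3`-congruence `393183a1[3] ≅ 393183l1[3]` PROVED IN THE KERNEL** (no named fact): `F = 393183a1 = [0, 0, 1, -237, 1876]` is `ℚ`-isomorphic to the member
`(λ : μ) = (-13983 : 1)` of the DUAL Hesse pencil `X_E⁻(3)` (Fisher 2012 §13) of `E = 393183l1 = [1, -1, 0, -5842746, -5434278881]` —
the two covariant identities `−𝔇(λ,μ)/(4Δ′) = u⁴·c₄(F)`, `−𝔠₆(λ,μ)/(8Δ′²) = u⁶·c₆(F)` (`Δ′ = c₄(E)³ − c₆(E)²`) with `u = 1/474`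
(`c₄(E) = 280451817`, `c₆(E) = 4696478986347`, `c₄(F) = 11376`, `c₆(F) = -1621080`) are checked by `norm_num` on the tree's closed forms
(`eval_hesseC4three` / `eval_hesseC6three` / `eval_hesseD3`) and fed to the PROVED transport
`Fisher2012.threeCongruent_of_dualHesseCertificate_unconditional`; certificate found by the seat's exact finder `find_hesse3.py`
(rational roots of the degree-12 form `𝔠₄′(λ,1)³c₆(F)² − 𝔠₆′(λ,1)²c₄(F)³`, k1-c3 g8). Hypothesis: the target model `hWeq` only.
[cite: Fisher2012Hessian, §13 (analogue of Thm. 13.2 for X_E^-(3))] [cite: Cremona2006, Table 1 (Cremona labels 393183l1, 393183a1)] -/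
theorem threeCongruent_c393183l1_c393183a1 (W : WeierstrassCurve ℚ) [W.IsElliptic] (hWeq : W = ⟨1, -1, 0, -5842746, -5434278881⟩) :
    ∃ θ : geomTorsion (⟨0, 0, 1, -237, 1876⟩ : WeierstrassCurve ℚ) (3 : ℤ) ≃+ geomTorsion W (3 : ℤ),
      ∀ (σ : Field.absoluteGaloisGroup ℚ) (P : geomTorsion (⟨0, 0, 1, -237, 1876⟩ : WeierstrassCurve ℚ) (3 : ℤ)),
        θ (σ • P) = σ • θ P := by
  haveI := isElliptic_c393183a1
  have hc4 : W.c₄ = (280451817 : ℚ) := by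
    subst hWeq; norm_num [WeierstrassCurve.c₄, WeierstrassCurve.b₂, WeierstrassCurve.b₄]
  have hc6 : W.c₆ = (4696478986347 : ℚ) := by
    subst hWeq; norm_num [WeierstrassCurve.c₆, WeierstrassCurve.b₂, WeierstrassCurve.b₄, WeierstrassCurve.b₆]
  have hc4F : (⟨0, 0, 1, -237, 1876⟩ : WeierstrassCurve ℚ).c₄ = (11376 : ℚ) := by
    norm_num [WeierstrassCurve.c₄, WeierstrassCurve.b₂, WeierstrassCurve.b₄]
  have hc6F : (⟨0, 0, 1, -237, 1876⟩ : WeierstrassCurve ℚ).c₆ = (-1621080 : ℚ) := by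
    norm_num [WeierstrassCurve.c₆, WeierstrassCurve.b₂, WeierstrassCurve.b₄, WeierstrassCurve.b₆]
  exact threeCongruent_of_dualHesseCertificate_unconditional W (⟨0, 0, 1, -237, 1876⟩ : WeierstrassCurve ℚ)
    (-13983 : ℚ) (1 : ℚ) ((1 : ℚ) / 474) (by norm_num)
    (by rw [hc4, hc6, hc4F, eval_hesseD3]; norm_num) (by rw [hc4, hc6, hc6F, eval_hesseC6three]; norm_num)

/-- **`ord₃ #Ш(E)_an ≤ ord₃ #Ш(E)` for `E = 393183l1` (crux 19359's conclusion `MissingLowerBoundAt W 3` AT THE PAIR), `3`-congruence PROVED IN THE KERNEL.**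
Binders: cite-only `hCT hGZK`; the model `hWeq`; Cremona's `r_an = 1` (`hr1`) and `#Ш(E)_an = q`, `ord₃ q ≤ 2` (`hq`/`hv`). Everything else —
the partner `F = 393183a1` (rank `3`), its minimal model, the two witnesses and their local `3`-divisibility, independence mod `3F(ℚ)`,
`E[3]` irreducible, AND the `3`-congruence `F[3] ≅ E[3]` — is decided in the kernel (`missingLowerBoundAt_c393183l1_3_of_congr` +
`threeCongruent_c393183l1_c393183a1`). Per pair; NOT a class theorem; nothing booked. [cite: CremonaMazur2000, §3] [cite: AgasheStein2002, Lemma 3.6]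
[cite: Fisher2012Hessian, Thm. 13.2 and §13 (n = 3)] [cite: Cremona2006, Table 1 (Cremona labels 393183l1, 393183a1)] -/
theorem missingLowerBoundAt_c393183l1_3
    (hCT : exists_casselsTate_pairing (K := ℚ)) (hGZK : rank_eq_analyticRank_of_analyticRank_le_one)
    {W : WeierstrassCurve ℚ} [W.IsElliptic] [W.IsGloballyMinimal] (hWeq : W = ⟨1, -1, 0, -5842746, -5434278881⟩)
    (hr1 : W.analyticRank = 1) {q : ℚ} (hq : shaAn W = (q : ℂ)) (hv : padicValRat 3 q ≤ 2) :
    MissingLowerBoundAt W 3 := by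
  haveI := isElliptic_c393183a1
  haveI := isGloballyMinimal_c393183a1
  obtain ⟨θ, hθ⟩ := threeCongruent_c393183l1_c393183a1 W hWeq
  exact missingLowerBoundAt_c393183l1_3_of_congr (F := (⟨0, 0, 1, -237, 1876⟩ : WeierstrassCurve ℚ)) hCT hGZK hWeq rfl hr1 hq hv θ hθ

/-- **`BSD(E,3)` for `E = 393183l1` BY NAME on cell X4(M) ∩ surj, `3`-congruence PROVED IN THE KERNEL** — cite-only
`hCyc h73 hWald hmodN hDelM hK hmod hmodD hGZK hCT`; the model `hWeq`; data-level flags `ClassX4M W 3`, `Surj W 3`, `r_an = 1`; the bit `A′ ≠ 0` on the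
multiplicative `χ₋₃`-branch (`hne`, k1-c4's two-engine shape); the EXACT datum `#Ш(E)_an = q`, `ord₃ q ≤ 2`. NO partner binder, NO `θ`
(`…_of_lower` + `missingLowerBoundAt_c393183l1_3`). Per pair; NOT a class theorem; nothing booked.
[cite: Kato2004Asterisque, Thm. 17.4 (3) (p. 273)] [cite: Delbourgo2002, Theorem (A), (B) (p. 40)] [cite: CremonaMazur2000, §3]
[cite: Fisher2012Hessian, Thm. 13.2 and §13 (n = 3)] [cite: Cremona2006, Table 1 (Cremona labels 393183l1, 393183a1)] -/
theorem bsdp_c393183l1_3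
    (hCyc : delbourgoDatum_cycLineGrossZagier) (h73 : GrossZagier1986_thm_I_7_3)
    (hWald : waldspurger_exists_heegnerField_twist_ne_zero) (hmodN : exists_isNewformOf)
    (hDelM : Delbourgo2002.mainTheorem_potMult)
    (hK : Wuthrich2014.kato_halfEigenCharIdeal_dvd_cyclotomicPrime_of_surjective)
    (hmod : hasEntireLFunction_rat) (hmodD : nonempty_modularParametrizationData)
    (hGZK : rank_eq_analyticRank_of_analyticRank_le_one) (hCT : exists_casselsTate_pairing (K := ℚ))
    {W : WeierstrassCurve ℚ} [W.IsElliptic] [W.IsGloballyMinimal] (hWeq : W = ⟨1, -1, 0, -5842746, -5434278881⟩)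
    (hX : ClassX4M W 3) (hsurj : Surj W 3) (hr1 : W.analyticRank = 1)
    (hne : ∀ (V : WeierstrassCurve ℚ) [V.IsElliptic] [V.IsGloballyMinimal] (C : VariableChange ℚ),
      Mult V 3 → C • V.quadraticTwist ((-1 : ℚ) ^ (3 / 2) * 3) = W →
      ∀ {N : ℕ} [NeZero N] (f : CuspForm (Gamma0 N) 2), IsNewformOf V f → ∀ (ap : ℤ), cuspCoeff f 3 = ap →
      ∀ ϖ : ℚ, (if Even (3 / 2) then (ϖ : ℝ) * V.realPeriodRat = plusPeriod f
          else (ϖ : ℝ) * V.imaginaryPeriodRat = minusPeriod f) →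
        PowerSeries.coeff 1 (PowerSeries.C (ϖ : ℚ_[3]) *
            (if Even (3 / 2) then padicLFunctionPlusBranchMult f (ap : ℚ_[3]) (3 / 2)
              else padicLFunctionMinusBranchMult f (ap : ℚ_[3]) (3 / 2))) ≠ 0)
    {q : ℚ} (hq : shaAn W = (q : ℂ)) (hv : padicValRat 3 q ≤ 2) : BSDp W 3 :=
  haveI : Fact (Nat.Prime 3) := ⟨Nat.prime_three⟩
  classX4M_bsdp_rankOne_of_cycLineFact_of_katoHalf_of_multCoeffOneNeZero_of_lower hCyc h73 hWald hmodN hDelM hK hmod hmodD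
    hGZK hX hsurj hr1 hne (missingLowerBoundAt_c393183l1_3 hCT hGZK hWeq hr1 hq hv)

/-! ### `409149y1` ← `409149g1` (direct pencil) -/

/-- **The `3`-congruence `409149g1[3] ≅ 409149y1[3]` PROVED IN THE KERNEL** (no named fact): `F = 409149g1 = [1, -1, 1, -149, 1122]` is `ℚ`-isomorphic to the member
`(λ : μ) = (-1203852 : 5)` of the DIRECT Hesse pencil `X_E(3)` (Fisher 2012 Thm. 13.2) of `E = 409149y1 = [0, 0, 1, -1205837139, -16116884577635]` —
the two covariant identities `𝔠₄(λ,μ) = u⁴·c₄(F)`, `𝔠₆(λ,μ) = u⁶·c₆(F)` with `u = 164268`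
(`c₄(E) = 57880182672`, `c₆(E) = 13924988275076424`, `c₄(F) = 7137`, `c₆(F) = -937521`) are checked by `norm_num` on the tree's closed forms
(`eval_hesseC4three` / `eval_hesseC6three` / `eval_hesseD3`) and fed to the PROVED transport
`Fisher2012.threeCongruent_of_hesseCertificate_unconditional`; certificate found by the seat's exact finder `find_hesse3.py`
(rational roots of the degree-12 form `𝔠₄′(λ,1)³c₆(F)² − 𝔠₆′(λ,1)²c₄(F)³`, k1-c3 g8). Hypothesis: the target model `hWeq` only.
[cite: Fisher2012Hessian, Thm. 13.2 (n = 3)] [cite: Cremona2006, Table 1 (Cremona labels 409149y1, 409149g1)] -/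
theorem threeCongruent_c409149y1_c409149g1 (W : WeierstrassCurve ℚ) [W.IsElliptic] (hWeq : W = ⟨0, 0, 1, -1205837139, -16116884577635⟩) :
    ∃ θ : geomTorsion (⟨1, -1, 1, -149, 1122⟩ : WeierstrassCurve ℚ) (3 : ℤ) ≃+ geomTorsion W (3 : ℤ),
      ∀ (σ : Field.absoluteGaloisGroup ℚ) (P : geomTorsion (⟨1, -1, 1, -149, 1122⟩ : WeierstrassCurve ℚ) (3 : ℤ)),
        θ (σ • P) = σ • θ P := by
  haveI := isElliptic_c409149g1
  have hc4 : W.c₄ = (57880182672 : ℚ) := by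
    subst hWeq; norm_num [WeierstrassCurve.c₄, WeierstrassCurve.b₂, WeierstrassCurve.b₄]
  have hc6 : W.c₆ = (13924988275076424 : ℚ) := by
    subst hWeq; norm_num [WeierstrassCurve.c₆, WeierstrassCurve.b₂, WeierstrassCurve.b₄, WeierstrassCurve.b₆]
  have hc4F : (⟨1, -1, 1, -149, 1122⟩ : WeierstrassCurve ℚ).c₄ = (7137 : ℚ) := by
    norm_num [WeierstrassCurve.c₄, WeierstrassCurve.b₂, WeierstrassCurve.b₄]
  have hc6F : (⟨1, -1, 1, -149, 1122⟩ : WeierstrassCurve ℚ).c₆ = (-937521 : ℚ) := by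
    norm_num [WeierstrassCurve.c₆, WeierstrassCurve.b₂, WeierstrassCurve.b₄, WeierstrassCurve.b₆]
  exact threeCongruent_of_hesseCertificate_unconditional W (⟨1, -1, 1, -149, 1122⟩ : WeierstrassCurve ℚ)
    (-1203852 : ℚ) (5 : ℚ) (164268 : ℚ) (by norm_num)
    (by rw [hc4, hc6, hc4F, eval_hesseC4three]; norm_num) (by rw [hc4, hc6, hc6F, eval_hesseC6three]; norm_num)

/-- **`ord₃ #Ш(E)_an ≤ ord₃ #Ш(E)` for `E = 409149y1` (crux 19359's conclusion `MissingLowerBoundAt W 3` AT THE PAIR), `3`-congruence PROVED IN THE KERNEL.**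
Binders: cite-only `hCT hGZK`; the model `hWeq`; Cremona's `r_an = 1` (`hr1`) and `#Ш(E)_an = q`, `ord₃ q ≤ 2` (`hq`/`hv`). Everything else —
the partner `F = 409149g1` (rank `3`), its minimal model, the two witnesses and their local `3`-divisibility, independence mod `3F(ℚ)`,
`E[3]` irreducible, AND the `3`-congruence `F[3] ≅ E[3]` — is decided in the kernel (`missingLowerBoundAt_c409149y1_3_of_congr` +
`threeCongruent_c409149y1_c409149g1`). Per pair; NOT a class theorem; nothing booked. [cite: CremonaMazur2000, §3] [cite: AgasheStein2002, Lemma 3.6]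
[cite: Fisher2012Hessian, Thm. 13.2 and §13 (n = 3)] [cite: Cremona2006, Table 1 (Cremona labels 409149y1, 409149g1)] -/
theorem missingLowerBoundAt_c409149y1_3
    (hCT : exists_casselsTate_pairing (K := ℚ)) (hGZK : rank_eq_analyticRank_of_analyticRank_le_one)
    {W : WeierstrassCurve ℚ} [W.IsElliptic] [W.IsGloballyMinimal] (hWeq : W = ⟨0, 0, 1, -1205837139, -16116884577635⟩)
    (hr1 : W.analyticRank = 1) {q : ℚ} (hq : shaAn W = (q : ℂ)) (hv : padicValRat 3 q ≤ 2) :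
    MissingLowerBoundAt W 3 := by
  haveI := isElliptic_c409149g1
  haveI := isGloballyMinimal_c409149g1
  obtain ⟨θ, hθ⟩ := threeCongruent_c409149y1_c409149g1 W hWeq
  exact missingLowerBoundAt_c409149y1_3_of_congr (F := (⟨1, -1, 1, -149, 1122⟩ : WeierstrassCurve ℚ)) hCT hGZK hWeq rfl hr1 hq hv θ hθ

/-- **`BSD(E,3)` for `E = 409149y1` BY NAME on cell X4(M) ∩ surj, `3`-congruence PROVED IN THE KERNEL** — cite-only
`hCyc h73 hWald hmodN hDelM hK hmod hmodD hGZK hCT`; the model `hWeq`; data-level flags `ClassX4M W 3`, `Surj W 3`, `r_an = 1`; the bit `A′ ≠ 0` on the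
multiplicative `χ₋₃`-branch (`hne`, k1-c4's two-engine shape); the EXACT datum `#Ш(E)_an = q`, `ord₃ q ≤ 2`. NO partner binder, NO `θ`
(`…_of_lower` + `missingLowerBoundAt_c409149y1_3`). Per pair; NOT a class theorem; nothing booked.
[cite: Kato2004Asterisque, Thm. 17.4 (3) (p. 273)] [cite: Delbourgo2002, Theorem (A), (B) (p. 40)] [cite: CremonaMazur2000, §3]
[cite: Fisher2012Hessian, Thm. 13.2 and §13 (n = 3)] [cite: Cremona2006, Table 1 (Cremona labels 409149y1, 409149g1)] -/
theorem bsdp_c409149y1_3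
    (hCyc : delbourgoDatum_cycLineGrossZagier) (h73 : GrossZagier1986_thm_I_7_3)
    (hWald : waldspurger_exists_heegnerField_twist_ne_zero) (hmodN : exists_isNewformOf)
    (hDelM : Delbourgo2002.mainTheorem_potMult)
    (hK : Wuthrich2014.kato_halfEigenCharIdeal_dvd_cyclotomicPrime_of_surjective)
    (hmod : hasEntireLFunction_rat) (hmodD : nonempty_modularParametrizationData)
    (hGZK : rank_eq_analyticRank_of_analyticRank_le_one) (hCT : exists_casselsTate_pairing (K := ℚ))
    {W : WeierstrassCurve ℚ} [W.IsElliptic] [W.IsGloballyMinimal] (hWeq : W = ⟨0, 0, 1, -1205837139, -16116884577635⟩)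
    (hX : ClassX4M W 3) (hsurj : Surj W 3) (hr1 : W.analyticRank = 1)
    (hne : ∀ (V : WeierstrassCurve ℚ) [V.IsElliptic] [V.IsGloballyMinimal] (C : VariableChange ℚ),
      Mult V 3 → C • V.quadraticTwist ((-1 : ℚ) ^ (3 / 2) * 3) = W →
      ∀ {N : ℕ} [NeZero N] (f : CuspForm (Gamma0 N) 2), IsNewformOf V f → ∀ (ap : ℤ), cuspCoeff f 3 = ap →
      ∀ ϖ : ℚ, (if Even (3 / 2) then (ϖ : ℝ) * V.realPeriodRat = plusPeriod f
          else (ϖ : ℝ) * V.imaginaryPeriodRat = minusPeriod f) →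
        PowerSeries.coeff 1 (PowerSeries.C (ϖ : ℚ_[3]) *
            (if Even (3 / 2) then padicLFunctionPlusBranchMult f (ap : ℚ_[3]) (3 / 2)
              else padicLFunctionMinusBranchMult f (ap : ℚ_[3]) (3 / 2))) ≠ 0)
    {q : ℚ} (hq : shaAn W = (q : ℂ)) (hv : padicValRat 3 q ≤ 2) : BSDp W 3 :=
  haveI : Fact (Nat.Prime 3) := ⟨Nat.prime_three⟩
  classX4M_bsdp_rankOne_of_cycLineFact_of_katoHalf_of_multCoeffOneNeZero_of_lower hCyc h73 hWald hmodN hDelM hK hmod hmodD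
    hGZK hX hsurj hr1 hne (missingLowerBoundAt_c409149y1_3 hCT hGZK hWeq hr1 hq hv)

end Summit.BirchSwinnertonDyer.BirchSwinnertonDyer.Theorems.AdditiveBranchIMCMultLowerVisibility

end
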